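import Summits.Ventures.PercRepro.C041SeedMonotone
import Summits.Ventures.PercRepro.C041TriangleSeedRegion
import Summits.Ventures.PercRepro.C041StarBoundsThree
import Summits.Ventures.PercRepro.C041StarBoundsTail

/-!
# THE LAST SEED ON THE `P₁ → ∞` TAIL: every star with `P₁ ≥ 16` (mine-3, gen 65; C-041.md §21 (az))

For a star `a` with `m + 2` leaves and `P₁ = ∏ (1 + aᵢ²) ≥ 16` the tail star inequality (T2) `4 (1 − A)² ≤ P₁ (P₂ − 1)`
(`tail_star_ineq`, C041StarBoundsTail) lets `P₂` be lowered to the hyperbola `p₂ = 1 + 4 (1 − A)² / P₁` (`InCone_thetaTri_v1_of_le`,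
the seed is monotone in `P₂`), and on that hyperbola the six conditions of the certificate `L₁` (`InCone_thetaTri_v1_of_L1`) are
polynomial inequalities in `(P₁, A, B)` that follow from `P₁ ≥ 16`, `0 ≤ A < 1`, `0 ≤ B ≤ (1 − A)²` (`prod_one_sub_le_sq_one_sub_prod`)
and `P₁² B ≤ 1` (`prod_one_add_sq_sq_mul_prod_one_sub_le_one`) — the key consequence being `P₁ B ≤ 1 − A` (`tail_BP_le`), which
makes `Δ₂ = 16 (1 − A)²/P₁ − 2 B (1 − A) ≥ 14 (1 − A)²/P₁ > 0` and the Hankel determinant `m₂ Δ₂ − (Δ₁ − Δ₂)²` non-negative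
(`tail_hankel`, after clearing `P₁²`: a polynomial in `(P₁, u = 1 − A, t = B P₁)` with `0 ≤ t ≤ u ≤ 1`, `P₁ ≥ 16`).
The star with all leaves `1` (`A = 1`) is `4·𝟙 + (2P₁ + 6)·v 1 + (3P₁ − 4)·v 1²` after lowering `P₂` to `1` (`InCone_thetaTri_v1_all_ones`).
**`InCone_thetaTri_v1_V_tail`**: every star with `m ≥ 2` leaves and `P₁ ≥ 16` has `θ_△(v 1, V a) ∈ cone`.
-/

namespace PercRepro

namespace RelaxedTriangle

open TreeClosure

/-- `P₁ B ≤ 1 − A` from `B ≤ (1 − A)²` and `P₁² B ≤ 1`: `(P₁ B)² = (P₁² B)·B ≤ B ≤ (1 − A)²`. -/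
theorem tail_BP_le (P1 A B : ℝ) (hP : 0 < P1) (hA1 : A ≤ 1) (hB0 : 0 ≤ B) (hBu : B ≤ (1 - A) ^ 2)
    (hBP : P1 ^ 2 * B ≤ 1) : P1 * B ≤ 1 - A := by
  have h1 : (P1 * B) ^ 2 ≤ (1 - A) ^ 2 := by
    have e : (P1 * B) ^ 2 = (P1 ^ 2 * B) * B := by ring
    rw [e]
    calc (P1 ^ 2 * B) * B ≤ 1 * B := mul_le_mul_of_nonneg_right hBP hB0
      _ = B := one_mul B
      _ ≤ (1 - A) ^ 2 := hBu
  have h2 : 0 ≤ 1 - A := by linarith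
  have h3 : 0 ≤ P1 * B := mul_nonneg hP.le hB0
  exact (pow_le_pow_iff_left₀ h3 h2 two_ne_zero).1 h1

/-- The Hankel polynomial of the tail: `P₁² (m₂ Δ₂ − (Δ₁ − Δ₂)²) / (1 − A)` in the variables `P = P₁`, `u = 1 − A`,
`t = B P₁` is non-negative for `P ≥ 16`, `0 ≤ t ≤ u ≤ 1`. -/
theorem tail_hankel_poly (P u t : ℝ) (hP : 16 ≤ P) (hu0 : 0 ≤ u) (hu1 : u ≤ 1) (ht0 : 0 ≤ t) (htu : t ≤ u) :
    0 ≤ 12 * P ^ 2 * u - 6 * P ^ 2 * t - 64 * P * u + 8 * P * t + 80 * P * u ^ 2 + 26 * P * t * u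
      - 96 * u ^ 3 - 20 * u ^ 2 * t + 16 * u * t - 2 * t ^ 2 - 5 * u * t ^ 2 := by
  have hP0 : 0 ≤ P := by linarith
  have h1 : 0 ≤ P ^ 2 * (u - t) := mul_nonneg (sq_nonneg P) (by linarith)
  have h2 : 0 ≤ P * u * (6 * P - 64) := mul_nonneg (mul_nonneg hP0 hu0) (by linarith)
  have h3 : 0 ≤ u ^ 2 * (80 * P - 123) := mul_nonneg (sq_nonneg u) (by linarith)
  have h4 : 0 ≤ u ^ 2 * (1 - u) := mul_nonneg (sq_nonneg u) (by linarith)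
  have h5 : 0 ≤ u ^ 2 * (u - t) := mul_nonneg (sq_nonneg u) (by linarith)
  have h6 : 0 ≤ (u - t) * (u + t) := mul_nonneg (by linarith) (by linarith)
  have h7 : 0 ≤ u * ((u - t) * (u + t)) := mul_nonneg hu0 h6
  have h8 : 0 ≤ u * (1 - u) := mul_nonneg hu0 (by linarith)
  have h9 : 0 ≤ P * t := mul_nonneg hP0 ht0
  have h10 : 0 ≤ P * t * u := mul_nonneg h9 hu0
  have h11 : 0 ≤ u * t := mul_nonneg hu0 ht0
  nlinarith [h1, h2, h3, h4, h5, h6, h7, h8, h9, h10, h11]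

/-- The Hankel condition of `L₁` on the tail hyperbola `p₂ = 1 + 4 u²/P` (`u = 1 − A`): for `P ≥ 16`, `0 < u ≤ 1`,
`0 ≤ B` and `B P ≤ u`. -/
theorem tail_hankel (P u B : ℝ) (hP : 16 ≤ P) (hu0 : 0 < u) (hu1 : u ≤ 1) (hB0 : 0 ≤ B) (ht : B * P ≤ u) :
    (6 * u - 2 * (4 * u ^ 2 / P) - 2 * B * u) ^ 2
      ≤ ((6 * P - 10 - 4 * u ^ 2 / P - (1 - u) * B + 2 * (1 - u) + 3 * B) / 2) * (4 * (4 * u ^ 2 / P) - 2 * B * u) := by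
  have hP0 : 0 < P := by linarith
  have hD := tail_hankel_poly P u (B * P) hP hu0.le hu1 (mul_nonneg hB0 hP0.le) ht
  have key : ((6 * P - 10 - 4 * u ^ 2 / P - (1 - u) * B + 2 * (1 - u) + 3 * B) / 2) * (4 * (4 * u ^ 2 / P) - 2 * B * u)
      - (6 * u - 2 * (4 * u ^ 2 / P) - 2 * B * u) ^ 2
      = u * (12 * P ^ 2 * u - 6 * P ^ 2 * (B * P) - 64 * P * u + 8 * P * (B * P) + 80 * P * u ^ 2 + 26 * P * (B * P) * u
          - 96 * u ^ 3 - 20 * u ^ 2 * (B * P) + 16 * u * (B * P) - 2 * (B * P) ^ 2 - 5 * u * (B * P) ^ 2) / P ^ 2 := by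
    field_simp
    ring
  have hnn : 0 ≤ u * (12 * P ^ 2 * u - 6 * P ^ 2 * (B * P) - 64 * P * u + 8 * P * (B * P) + 80 * P * u ^ 2 + 26 * P * (B * P) * u
          - 96 * u ^ 3 - 20 * u ^ 2 * (B * P) + 16 * u * (B * P) - 2 * (B * P) ^ 2 - 5 * u * (B * P) ^ 2) / P ^ 2 :=
    div_nonneg (mul_nonneg hu0.le hD) (sq_nonneg P)
  linarith [key, hnn]

/-- **THE SEED AT A TAIL POINT**: for `P₁ ≥ 16`, `0 ≤ A < 1`, `0 ≤ B ≤ (1 − A)²`, `P₁² B ≤ 1`, the point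
`(1, P₁, 1 + 4 (1 − A)²/P₁, AB, A, B)` lies in the `L₁`-region, so its seed is in the cone. -/
theorem InCone_thetaTri_v1_tail_point (P1 A B : ℝ) (hP : 16 ≤ P1) (hA0 : 0 ≤ A) (hA1 : A < 1) (hB0 : 0 ≤ B)
    (hBu : B ≤ (1 - A) ^ 2) (hBP : P1 ^ 2 * B ≤ 1) :
    InCone (thetaTri (v 1) ![1, P1, 1 + 4 * (1 - A) ^ 2 / P1, A * B, A, B]) := by
  have hP0 : 0 < P1 := by linarith
  have hu : 0 < 1 - A := by linarith
  have ht : P1 * B ≤ 1 - A := tail_BP_le P1 A B hP0 hA1.le hB0 hBu hBP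
  have hB1 : B ≤ 1 := by nlinarith
  have he0 : 0 ≤ 4 * (1 - A) ^ 2 / P1 := by positivity
  -- `4 B (1 − A) ≤ e = 4 (1 − A)²/P₁`
  have hBe : 4 * B * (1 - A) ≤ 4 * (1 - A) ^ 2 / P1 := by
    rw [le_div_iff₀ hP0]
    nlinarith [mul_le_mul_of_nonneg_right ht hu.le]
  -- `4 e ≤ 1 − A`
  have he4 : 4 * (4 * (1 - A) ^ 2 / P1) ≤ 1 - A := by
    rw [← mul_div_assoc, div_le_iff₀ hP0]
    nlinarith [mul_nonneg hu.le hu.le, hA0]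
  have hH := tail_hankel P1 (1 - A) B hP hu (by linarith) hB0 (by linarith [ht])
  have hAB : A * B ≤ 1 := by nlinarith
  have w0 : (![1, P1, 1 + 4 * (1 - A) ^ 2 / P1, A * B, A, B] : Vec6) 0 = 1 := rfl
  have w1 : (![1, P1, 1 + 4 * (1 - A) ^ 2 / P1, A * B, A, B] : Vec6) 1 = P1 := rfl
  have w2 : (![1, P1, 1 + 4 * (1 - A) ^ 2 / P1, A * B, A, B] : Vec6) 2 = 1 + 4 * (1 - A) ^ 2 / P1 := rfl
  have w3 : (![1, P1, 1 + 4 * (1 - A) ^ 2 / P1, A * B, A, B] : Vec6) 3 = A * B := rfl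
  have w4 : (![1, P1, 1 + 4 * (1 - A) ^ 2 / P1, A * B, A, B] : Vec6) 4 = A := rfl
  have w5 : (![1, P1, 1 + 4 * (1 - A) ^ 2 / P1, A * B, A, B] : Vec6) 5 = B := rfl
  apply InCone_thetaTri_v1_of_L1 ![1, P1, 1 + 4 * (1 - A) ^ 2 / P1, A * B, A, B] <;> simp only [w0, w1, w2, w3, w4, w5]
  · nlinarith [hBe, he0, hu]
  · nlinarith [he4, hu, mul_nonneg hB0 hu.le]
  · nlinarith [mul_nonneg hA0 hB0]
  · nlinarith [mul_nonneg hB0 hu.le, he0]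
  · nlinarith [he0, hAB, mul_nonneg hA0 hB0]
  · nlinarith [hH]

/-- The star with all leaves `1`, `P₂` lowered to `1`: `θ_△(v 1, (1, P₁, 1, 0, 1, 0)) = 4·𝟙 + (2 P₁ + 6)·v 1 + (3 P₁ − 4)·v 1²`. -/
theorem thetaTri_v1_all_ones_eq (P1 : ℝ) :
    thetaTri (v 1) ![1, P1, 1, 0, 1, 0]
      = (4 : ℝ) • (1 : Vec6) + (2 * P1 + 6) • v 1 + (3 * P1 - 4) • (v 1 * v 1) := by
  rw [thetaTri_v1_coords]
  ext i
  simp only [Pi.add_apply, Pi.smul_apply, Pi.mul_apply, Pi.one_apply, smul_eq_mul, v]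
  fin_cases i <;> simp <;> ring

/-- The star with all leaves `1`: after lowering `P₂` to `1` the seed is `4·𝟙 + (2 P₁ + 6)·v 1 + (3 P₁ − 4)·v 1²`
(`P₁ ≥ 4/3`). -/
theorem InCone_thetaTri_v1_all_ones (P1 : ℝ) (hP : 4 / 3 ≤ P1) :
    InCone (thetaTri (v 1) ![1, P1, 1, 0, 1, 0]) := by
  rw [thetaTri_v1_all_ones_eq]
  refine InCone.add (InCone.add (InCone.smul _ (by norm_num) InCone_one) ?_) ?_
  · exact InCone.smul _ (by linarith) (InCone_v 1 ⟨zero_le_one, le_rfl⟩)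
  · exact InCone.smul _ (by linarith) (InCone.mul (InCone_v 1 ⟨zero_le_one, le_rfl⟩) (InCone_v 1 ⟨zero_le_one, le_rfl⟩))

/-- **THE SEED ON THE TAIL.** Every star with `m ≥ 2` leaves in `[0, 1]` and `P₁ = ∏ (1 + aᵢ²) ≥ 16` has
`θ_△(v 1, V a) ∈ cone`. -/
theorem InCone_thetaTri_v1_V_tail {m : ℕ} (a : Fin (m + 2) → ℝ) (ha : ∀ i, 0 ≤ a i ∧ a i ≤ 1)
    (hP : 16 ≤ ∏ i, (1 + a i ^ 2)) : InCone (thetaTri (v 1) (V a)) := by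
  have hc := TreeClosure.V_coords a
  obtain ⟨hA0, hA1⟩ := prod_unit_mem a ha
  obtain ⟨hB0, hB1⟩ := prod_unit_mem (fun i => 1 - a i) (fun i => ⟨by linarith [(ha i).2], by linarith [(ha i).1]⟩)
  have hBu := prod_one_sub_le_sq_one_sub_prod a ha
  have hBP := prod_one_add_sq_sq_mul_prod_one_sub_le_one a ha
  have hT2 := tail_star_ineq a ha hP
  have h2 := one_add_prod_one_sub_sq_le a ha
  set P1 := ∏ i, (1 + a i ^ 2) with hP1
  set P2 := ∏ i, (1 + (1 - a i) ^ 2) with hP2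
  set A := ∏ i, a i with hAd
  set B := ∏ i, (1 - a i) with hBd
  have hw : V a = ![1, P1, P2, A * B, A, B] := by
    ext i
    fin_cases i <;> simp [hc.1, hc.2.1, hc.2.2.1, hc.2.2.2.1, hc.2.2.2.2.1, hc.2.2.2.2.2]
  rw [hw]
  have hP0 : 0 < P1 := by linarith
  rcases eq_or_lt_of_le hA1 with hA | hA
  · -- all leaves `1`: `B = 0`, lower `P₂` to `1`
    have hB : B = 0 := by
      have : B ≤ (1 - A) ^ 2 := hBu
      rw [hA] at this
      simp at this
      linarith
    have hp2 : (1 : ℝ) ≤ P2 := by nlinarith [sq_nonneg B]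
    refine InCone_thetaTri_v1_of_le (w := ![1, P1, P2, A * B, A, B]) (p1 := P1) (p2 := 1) (by simp) (by simpa using hp2) ?_
    have hv : (![(![1, P1, P2, A * B, A, B] : Vec6) 0, P1, 1, (![1, P1, P2, A * B, A, B] : Vec6) 3,
        (![1, P1, P2, A * B, A, B] : Vec6) 4, (![1, P1, P2, A * B, A, B] : Vec6) 5] : Vec6) = ![1, P1, 1, 0, 1, 0] := by
      ext i
      fin_cases i <;> simp [hA, hB]
    rw [hv]
    exact InCone_thetaTri_v1_all_ones P1 (by linarith)
  · -- `A < 1`: lower `P₂` to the hyperbola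
    have hp2 : 1 + 4 * (1 - A) ^ 2 / P1 ≤ P2 := by
      rw [← sub_nonneg]
      have : P2 - (1 + 4 * (1 - A) ^ 2 / P1) = (P1 * (P2 - 1) - 4 * (1 - A) ^ 2) / P1 := by
        field_simp
        ring
      rw [this]
      exact div_nonneg (by linarith) hP0.le
    refine InCone_thetaTri_v1_of_le (w := ![1, P1, P2, A * B, A, B]) (p1 := P1) (p2 := 1 + 4 * (1 - A) ^ 2 / P1)
      (by simp) (by simpa using hp2) ?_
    exact InCone_thetaTri_v1_tail_point P1 A B hP hA0 hA hB0 hBu hBP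

end RelaxedTriangle

end PercRepro
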